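import Literature.AnabelianGeometry.SemiGraphs.PSCTwoTripodOrigin
import Literature.AnabelianGeometry.SemiGraphs.PSCEdgeLikeIncidenceCriteria
import HarnessLib

/-!
# The two-tripod PSC datum, II: [CombGC] Prop. 1.5 (i) (incidence of edge-like subgroups) holds

Mochizuki, *A combinatorial version of the Grothendieck conjecture* [CombGC] §1, Prop. 1.5 (i), p. 12
[cite: MochizukiCombGC2007, Prop 1.5(i) p.12].  Continuation of `PSCTwoTripodOrigin.lean` (the stable
curve "two tripods glued at a node", `Π` = pro-`Σ` completion of `Γ_{0,4}`, `Π_{v₁} = closure ι⟨c₁,c₁c₂⟩`,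
`Π_{v₂} = closure ι⟨c₁c₂, c₃⟩`, `Π_e = closure ι⟨c₁c₂⟩`, `Π_{c_j} = closure ι⟨c_j⟩`).  Here the
genuinely multi-vertex content of Prop. 1.5 (i) is verified at this datum:

* `twoTripod_edgeLikeIncidence` — every cuspidal subgroup lies in EXACTLY ONE verticial subgroup and
  the nodal subgroups in EXACTLY TWO.  The uniqueness is free-factor MALNORMALITY of the rank-two
  verticial groups (`mem_freeFactor_of_inf_conj_ne_bot`, Ribes–Zalesskii Thm. 9.1.12 proved in the tree,
  `ProSigmaFreeFactorMalnormal.lean`), fed through the criterion `edgeLikeIncidence_of`; the separation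
  of an edge group from the conjugates of the OTHER vertex group is `freeFactor_inf_conj_eq_bot_of_disjoint`
  in the three Nielsen bases of `PuncturedSurfaceGroupZeroFourBases.lean`;
* `exists_twoVertexOrigin_holds_incidence` — the origin of two-tripod-shaped data satisfies F-0438
  (`CommensurableTerminalityHolds`), F-0459 (`OpenInterDeterminesComponentHolds`) AND F-0440
  (`EdgeLikeIncidenceHolds`), and is inhabited by the genuine datum over `Γ̂_{0,4}`.

Instance forms at genuine anabelian data; consistency evidence for the typed schemata, not the printed
theorems for all pointed stable curves.  No side is taken on [IUTchIII] Cor. 3.12.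
-/

noncomputable section

namespace Literature.AnabelianGeometry.SemiGraphs

namespace PSCDatum

open scoped Pointwise
open Literature.GroupTheory.CombinatorialGroupTheory
open SemiGraphOfAnabelioids (IsProSigmaCompletion infinite_cuspInertia_closure)
open SemiGraphOfAnabelioids.IsProSigmaCompletion (freeFactor_inf_conj_eq_bot_of_disjoint
  infinite_freeFactor mem_freeFactor_of_inf_conj_ne_bot)

universe u

variable {P : Type u} [Group P] [TopologicalSpace P] [IsTopologicalGroup P] [CompactSpace P]
  [T2Space P] [TotallyDisconnectedSpace P] {Sigma : Set ℕ}

omit [TopologicalSpace P] [IsTopologicalGroup P] [CompactSpace P] [T2Space P]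
  [TotallyDisconnectedSpace P] in
/-- An infinite subgroup is not trivial. [cite: MochizukiCombGC2007, Rmk 1.1.3 p.7] -/
private theorem ne_bot_of_infinite' {H : Subgroup P} (h : Infinite H) : H ≠ ⊥ := by
  rintro rfl
  exact h.not_finite inferInstance

/-- **Prop. 1.5 (i) at two-tripod shape** (`b 0 = c₁`, `b 1 = c₁c₂`, `b 2 = c₃`; two distinct vertices
with `Π_{v₁} = closure ι⟨b₀,b₁⟩`, `Π_{v₂} = closure ι⟨b₁,b₂⟩`, one node with `Π_e = closure ι⟨b₁⟩`, the
cusps injectively labelled by `Fin 4` with the closed cusp inertia groups). [cite: MochizukiCombGC2007, Prop 1.5(i) p.12] -/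
theorem twoTripod_edgeLikeIncidence (hne : Sigma.Nonempty) (hprime : ∀ p ∈ Sigma, p.Prime)
    (ι : PuncturedSurfaceGroup 0 4 →* P) (hι : IsProSigmaCompletion Sigma ι)
    (b : FreeGroupBasis (Fin 3) (PuncturedSurfaceGroup 0 4))
    (hb : b 0 = PuncturedSurfaceGroup.c 1 ∧
      b 1 = PuncturedSurfaceGroup.c 1 * PuncturedSurfaceGroup.c 2 ∧ b 2 = PuncturedSurfaceGroup.c 3)
    (G : PSCDatum P) (v₁ v₂ : G.graph.V) (hv : v₁ ≠ v₂) (hV : ∀ v, v = v₁ ∨ v = v₂)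
    (hV₁ : G.vertGp v₁ = ((Subgroup.closure (b '' {0, 1})).map ι).topologicalClosure)
    (hV₂ : G.vertGp v₂ = ((Subgroup.closure (b '' {1, 2})).map ι).topologicalClosure)
    (hN : ∀ e, G.nodeGp e = ((Subgroup.closure (b '' {1})).map ι).topologicalClosure)
    (f : G.graph.C → Fin 4)
    (hC : ∀ c, G.cuspGp c =
      ((PuncturedSurfaceGroup.cuspInertia (g := 0) (f c)).map ι).topologicalClosure) :
    G.EdgeLikeIncidence := by
  have hp : ∃ p ∈ Sigma, p.Prime := by
    obtain ⟨p, hp⟩ := hne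
    exact ⟨p, hp, hprime p hp⟩
  have h04 : PuncturedSurfaceGroup.IsHyperbolicType 0 4 := by
    unfold PuncturedSurfaceGroup.IsHyperbolicType; norm_num
  obtain ⟨hb0, hb1, hb2⟩ := hb
  obtain ⟨b₂, hb₂0, hb₂1, hb₂2⟩ := PuncturedSurfaceGroup.exists_freeGroupBasis_node_two
  obtain ⟨b₄, hb₄0, hb₄1, hb₄2⟩ := PuncturedSurfaceGroup.exists_freeGroupBasis_node_zero
  -- the two verticial free factors, re-expressed in the other bases
  have hV₂' : Subgroup.closure (b '' {1, 2}) = Subgroup.closure (b₂ '' {0, 2}) := by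
    rw [Set.image_pair, Set.image_pair, hb1, hb2, hb₂0, hb₂2]
  have hV₁' : Subgroup.closure (b '' {0, 1}) = Subgroup.closure (b₄ '' {0, 1}) := by
    rw [Set.image_pair, Set.image_pair, hb0, hb1, hb₄0, hb₄1]
  -- cusp groups as singleton sub-basis closures
  have hK : ∀ j : Fin 4, ((PuncturedSurfaceGroup.cuspInertia (g := 0) j).map ι).topologicalClosure =
      ((Subgroup.zpowers (PuncturedSurfaceGroup.c j : PuncturedSurfaceGroup 0 4)).map ι).topologicalClosure :=
    fun j => rfl
  -- membership of the cusp generators / node generator in the verticial free factors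
  have hgen : ∀ (b' : FreeGroupBasis (Fin 3) (PuncturedSurfaceGroup 0 4)) (S : Set (Fin 3)) (k : Fin 3),
      k ∈ S → b' k ∈ Subgroup.closure (b' '' S) := fun b' S k hk => Subgroup.subset_closure ⟨k, hk, rfl⟩
  have hle : ∀ (x : PuncturedSurfaceGroup 0 4) (S : Set (Fin 3)), x ∈ Subgroup.closure (b '' S) →
      ((Subgroup.zpowers x).map ι).topologicalClosure ≤
        ((Subgroup.closure (b '' S)).map ι).topologicalClosure := fun x S hx =>
    Subgroup.topologicalClosure_mono (Subgroup.map_mono ((Subgroup.zpowers_le (g := x)).mpr hx))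
  have hc1 : (PuncturedSurfaceGroup.c 1 : PuncturedSurfaceGroup 0 4) ∈ Subgroup.closure (b '' {0, 1}) := by
    rw [← hb0]; exact hgen b _ 0 (by simp)
  have hc2 : (PuncturedSurfaceGroup.c 2 : PuncturedSurfaceGroup 0 4) ∈ Subgroup.closure (b '' {0, 1}) := by
    have : (PuncturedSurfaceGroup.c 2 : PuncturedSurfaceGroup 0 4) = (b 0)⁻¹ * b 1 := by
      rw [hb0, hb1, inv_mul_cancel_left]
    rw [this]
    exact Subgroup.mul_mem _ (Subgroup.inv_mem _ (hgen b _ 0 (by simp))) (hgen b _ 1 (by simp))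
  have hc3 : (PuncturedSurfaceGroup.c 3 : PuncturedSurfaceGroup 0 4) ∈ Subgroup.closure (b '' {1, 2}) := by
    rw [← hb2]; exact hgen b _ 2 (by simp)
  have hc0 : (PuncturedSurfaceGroup.c 0 : PuncturedSurfaceGroup 0 4) ∈ Subgroup.closure (b '' {1, 2}) := by
    have : (PuncturedSurfaceGroup.c 0 : PuncturedSurfaceGroup 0 4) = (b 1 * b 2)⁻¹ := by
      rw [hb1, hb2, PuncturedSurfaceGroup.c_zero_eq_inv]
    rw [this]
    exact Subgroup.inv_mem _ (Subgroup.mul_mem _ (hgen b _ 1 (by simp)) (hgen b _ 2 (by simp)))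
  -- the first cusp-type sub-factor separates the two verticial groups
  have hV₁₂ : G.vertGp v₁ ≠ G.vertGp v₂ := by
    intro h
    have h0 := freeFactor_inf_conj_eq_bot_of_disjoint b {0} {1, 2}
      (Set.disjoint_singleton_left.mpr (by simp)) hι 1
    rw [map_one, one_smul] at h0
    have hle0 : ((Subgroup.closure (b '' {0})).map ι).topologicalClosure ≤ G.vertGp v₂ := by
      rw [← h, hV₁]
      exact Subgroup.topologicalClosure_mono (Subgroup.map_mono (Subgroup.closure_mono
        (Set.image_mono (Set.singleton_subset_iff.mpr (by simp)))))
    rw [hV₂] at hle0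
    exact ne_bot_of_infinite' (infinite_freeFactor b {0} ⟨0, rfl⟩ hι hp)
      (le_bot_iff.mp (h0 ▸ le_inf le_rfl hle0))
  refine G.edgeLikeIncidence_of (fun v g h => ?_) (fun e => ?_) (fun c => ?_) (fun e c g => ?_)
    (fun e => ⟨v₁, v₂, ?_, ?_, hV₁₂, fun w hw₁ hw₂ => ?_⟩) (fun c => ?_)
  · -- malnormality of the verticial free factors
    rcases hV v with rfl | rfl
    · rw [hV₁] at h ⊢; exact mem_freeFactor_of_inf_conj_ne_bot b _ hι h
    · rw [hV₂] at h ⊢; exact mem_freeFactor_of_inf_conj_ne_bot b _ hι h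
  · rw [hN]; exact ne_bot_of_infinite' (infinite_freeFactor b _ ⟨1, rfl⟩ hι hp)
  · rw [hC]; exact ne_bot_of_infinite' (infinite_cuspInertia_closure hne hprime h04 ι hι (f c))
  · rw [hN, hC, freeFactor_singleton_eq, hb1]
    exact node_inf_conj_cusp_eq_bot hι (f c) g
  · rw [hN, hV₁, freeFactor_singleton_eq]; exact hle _ _ (hgen b _ 1 (by simp))
  · rw [hN, hV₂, freeFactor_singleton_eq]; exact hle _ _ (hgen b _ 1 (by simp))
  · rcases hV w with rfl | rfl
    · exact absurd rfl hw₁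
    · exact absurd rfl hw₂
  · -- each cusp: its vertex, and separation from the other vertex group
    rw [hC, hK]
    have hcases : ∀ j : Fin 4, j = 0 ∨ j = 1 ∨ j = 2 ∨ j = 3 := by decide
    rcases hcases (f c) with hj | hj | hj | hj <;> rw [hj]
    · -- `c₀` at `v₂`; against `Π_{v₁}` in the basis `(c₁, c₁c₂, c₀⁻¹)`
      refine ⟨v₂, by rw [hV₂]; exact hle _ _ hc0, fun w hw g => ?_⟩
      rcases hV w with rfl | rfl
      · have h := freeFactor_inf_conj_eq_bot_of_disjoint b₄ {2} {0, 1}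
          (Set.disjoint_singleton_left.mpr (by simp)) hι g
        rw [freeFactor_singleton_eq ι b₄ 2, hb₄2, Subgroup.zpowers_inv, ← hV₁'] at h
        rw [hV₁]
        exact h
      · exact absurd rfl hw
    · -- `c₁` at `v₁`; against `Π_{v₂}` in the basis `(c₁, c₁c₂, c₃)`
      refine ⟨v₁, by rw [hV₁]; exact hle _ _ hc1, fun w hw g => ?_⟩
      rcases hV w with rfl | rfl
      · exact absurd rfl hw
      · have h := freeFactor_inf_conj_eq_bot_of_disjoint b {0} {1, 2}
          (Set.disjoint_singleton_left.mpr (by simp)) hι g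
        rw [freeFactor_singleton_eq ι b 0, hb0] at h
        rw [hV₂]
        exact h
    · -- `c₂` at `v₁`; against `Π_{v₂}` in the basis `(c₁c₂, c₂, c₃)`
      refine ⟨v₁, by rw [hV₁]; exact hle _ _ hc2, fun w hw g => ?_⟩
      rcases hV w with rfl | rfl
      · exact absurd rfl hw
      · have h := freeFactor_inf_conj_eq_bot_of_disjoint b₂ {1} {0, 2}
          (Set.disjoint_singleton_left.mpr (by simp)) hι g
        rw [freeFactor_singleton_eq ι b₂ 1, hb₂1, ← hV₂'] at h
        rw [hV₂]
        exact h
    · -- `c₃` at `v₂`; against `Π_{v₁}` in the basis `(c₁, c₁c₂, c₃)`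
      refine ⟨v₂, by rw [hV₂]; exact hle _ _ hc3, fun w hw g => ?_⟩
      rcases hV w with rfl | rfl
      · have h := freeFactor_inf_conj_eq_bot_of_disjoint b {2} {0, 1}
          (Set.disjoint_singleton_left.mpr (by simp)) hι g
        rw [freeFactor_singleton_eq ι b 2, hb2] at h
        rw [hV₁]
        exact h
      · exact absurd rfl hw

/-! ### Origin level: F-0440 together with F-0438 / F-0459 at the two-tripod origin -/

section Origin

variable (Ω : PSCOrigin.{u})

/-- **F-0440 ([CombGC] Prop. 1.5 (i))** at every origin whose data are of two-tripod shape.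
[cite: MochizukiCombGC2007, Prop 1.5(i) p.12] -/
theorem edgeLikeIncidenceHolds_of_twoTripod
    (hΩ : ∀ ⦃Q : Type u⦄ [Group Q] [TopologicalSpace Q] (G : PSCDatum Q),
      Ω.IsOfPSCType G → ∃ (_ : IsTopologicalGroup Q), CompactSpace Q ∧ T2Space Q ∧
        TotallyDisconnectedSpace Q ∧
        ∃ (S : Set ℕ) (ι : PuncturedSurfaceGroup 0 4 →* Q)
          (b : FreeGroupBasis (Fin 3) (PuncturedSurfaceGroup 0 4)) (v₁ v₂ : G.graph.V)
          (f : G.graph.C → Fin 4),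
          S.Nonempty ∧ (∀ p ∈ S, p.Prime) ∧ IsProSigmaCompletion S ι ∧
          (b 0 = PuncturedSurfaceGroup.c 1 ∧ b 1 = PuncturedSurfaceGroup.c 1 * PuncturedSurfaceGroup.c 2 ∧
            b 2 = PuncturedSurfaceGroup.c 3) ∧
          v₁ ≠ v₂ ∧ (∀ v, v = v₁ ∨ v = v₂) ∧
          G.vertGp v₁ = ((Subgroup.closure (b '' {0, 1})).map ι).topologicalClosure ∧
          G.vertGp v₂ = ((Subgroup.closure (b '' {1, 2})).map ι).topologicalClosure ∧
          (∀ e, G.nodeGp e = ((Subgroup.closure (b '' {1})).map ι).topologicalClosure) ∧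
          (∀ e e' : G.graph.N, e = e') ∧ Function.Injective f ∧
          (∀ c, G.cuspGp c =
            ((PuncturedSurfaceGroup.cuspInertia (g := 0) (f c)).map ι).topologicalClosure) ∧
          G.genus v₁ < 2) :
    EdgeLikeIncidenceHolds Ω := by
  intro Q _ _ G hG
  obtain ⟨_, _, _, _, S, ι, b, v₁, v₂, f, hne, hprime, hι, hb, hv, hV, hV₁, hV₂, hN, -, -, hC, -⟩ :=
    hΩ G hG
  exact twoTripod_edgeLikeIncidence hne hprime ι hι b hb G v₁ v₂ hv hV hV₁ hV₂ hN f hC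

/-- **[CombGC] Prop. 1.2 (i)(ii) and Prop. 1.5 (i) (F-0459, F-0438, F-0440) HOLD at an origin inhabited
by the GENUINE TWO-VERTEX datum** "two tripods glued at a node" over `Π = Γ̂_{0,4}` (type `(0,4)`,
`i = 2`, `n = 1`, `r = 4`; the same origin `Ω₂` and datum as `exists_twoVertexOrigin_holds`).  The
multi-vertex content (uniqueness of the verticial subgroups containing an edge group) is free-factor
malnormality in the pro-`Σ` completion. [cite: MochizukiCombGC2007, Prop 1.5(i) p.12] -/
theorem exists_twoVertexOrigin_holds_incidence :
    ∃ Ω : PSCOrigin.{0},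
      (∃ G : PSCDatum (Literature.IUT.HodgeTheaters.profiniteCompletion (PuncturedSurfaceGroup 0 4)),
        Ω.IsOfPSCType G ∧ G.Sigma = {p : ℕ | p.Prime} ∧ G.graph.i = 2 ∧ G.graph.n = 1 ∧ G.graph.r = 4 ∧
          (∀ v, G.genus v = 0)) ∧
      CommensurableTerminalityHolds Ω ∧ OpenInterDeterminesComponentHolds Ω ∧ EdgeLikeIncidenceHolds Ω := by
  let Ω : PSCOrigin.{0} :=
    ⟨fun {Q} _ _ G => ∃ (_ : IsTopologicalGroup Q), CompactSpace Q ∧ T2Space Q ∧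
      TotallyDisconnectedSpace Q ∧
        ∃ (S : Set ℕ) (ι : PuncturedSurfaceGroup 0 4 →* Q)
          (b : FreeGroupBasis (Fin 3) (PuncturedSurfaceGroup 0 4)) (v₁ v₂ : G.graph.V)
          (f : G.graph.C → Fin 4),
          S.Nonempty ∧ (∀ p ∈ S, p.Prime) ∧ IsProSigmaCompletion S ι ∧
          (b 0 = PuncturedSurfaceGroup.c 1 ∧ b 1 = PuncturedSurfaceGroup.c 1 * PuncturedSurfaceGroup.c 2 ∧
            b 2 = PuncturedSurfaceGroup.c 3) ∧
          v₁ ≠ v₂ ∧ (∀ v, v = v₁ ∨ v = v₂) ∧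
          G.vertGp v₁ = ((Subgroup.closure (b '' {0, 1})).map ι).topologicalClosure ∧
          G.vertGp v₂ = ((Subgroup.closure (b '' {1, 2})).map ι).topologicalClosure ∧
          (∀ e, G.nodeGp e = ((Subgroup.closure (b '' {1})).map ι).topologicalClosure) ∧
          (∀ e e' : G.graph.N, e = e') ∧ Function.Injective f ∧
          (∀ c, G.cuspGp c =
            ((PuncturedSurfaceGroup.cuspInertia (g := 0) (f c)).map ι).topologicalClosure) ∧
          G.genus v₁ < 2⟩
  -- the genuine datum (as in `exists_twoVertexOrigin_holds`)
  let Γ := PuncturedSurfaceGroup 0 4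
  let η := Literature.IUT.HodgeTheaters.toCompletion Γ
  have hη : IsProSigmaCompletion {p : ℕ | p.Prime} η :=
    SemiGraphOfAnabelioids.IsProSigmaCompletion.isProSigmaCompletion_toCompletion Γ
  obtain ⟨b, hb0, hb1, hb2⟩ := PuncturedSurfaceGroup.exists_freeGroupBasis_node
  have hgen : ∀ (S : Set (Fin 3)) (k : Fin 3), k ∈ S → b k ∈ Subgroup.closure (b '' S) :=
    fun S k hk => Subgroup.subset_closure ⟨k, hk, rfl⟩
  have hle : ∀ (x : Γ) (S : Set (Fin 3)), x ∈ Subgroup.closure (b '' S) →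
      ((Subgroup.zpowers x).map η).topologicalClosure ≤
        ((Subgroup.closure (b '' S)).map η).topologicalClosure := fun x S hx =>
    Subgroup.topologicalClosure_mono (Subgroup.map_mono ((Subgroup.zpowers_le (g := x)).mpr hx))
  have hc1 : (PuncturedSurfaceGroup.c 1 : Γ) ∈ Subgroup.closure (b '' {0, 1}) := by
    rw [← hb0]; exact hgen _ 0 (by simp)
  have hc2 : (PuncturedSurfaceGroup.c 2 : Γ) ∈ Subgroup.closure (b '' {0, 1}) := by
    have : (PuncturedSurfaceGroup.c 2 : Γ) = (b 0)⁻¹ * b 1 := by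
      rw [hb0, hb1, inv_mul_cancel_left]
    rw [this]
    exact Subgroup.mul_mem _ (Subgroup.inv_mem _ (hgen _ 0 (by simp))) (hgen _ 1 (by simp))
  have hc3 : (PuncturedSurfaceGroup.c 3 : Γ) ∈ Subgroup.closure (b '' {1, 2}) := by
    rw [← hb2]; exact hgen _ 2 (by simp)
  have hc0 : (PuncturedSurfaceGroup.c 0 : Γ) ∈ Subgroup.closure (b '' {1, 2}) := by
    have : (PuncturedSurfaceGroup.c 0 : Γ) = (b 1 * b 2)⁻¹ := by
      rw [hb1, hb2, PuncturedSurfaceGroup.c_zero_eq_inv]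
    rw [this]
    exact Subgroup.inv_mem _ (Subgroup.mul_mem _ (hgen _ 1 (by simp)) (hgen _ 2 (by simp)))
  let T : PSCDatum (Literature.IUT.HodgeTheaters.profiniteCompletion Γ) :=
    { Sigma := {p | p.Prime}
      sigma_prime := fun _ hp => hp
      sigma_nonempty := ⟨2, Nat.prime_two⟩
      graph := { V := Fin 2, N := Unit, C := Fin 4, nodeEnds := fun _ => s(0, 1),
                 cuspEnd := ![1, 0, 0, 1] }
      vertGp := ![((Subgroup.closure (b '' {0, 1})).map η).topologicalClosure,
        ((Subgroup.closure (b '' {1, 2})).map η).topologicalClosure]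
      nodeGp := fun _ => ((Subgroup.closure (b '' {1})).map η).topologicalClosure
      cuspGp := fun j => ((PuncturedSurfaceGroup.cuspInertia (g := 0) j).map η).topologicalClosure
      genus := fun _ => 0
      isClosed_vertGp := fun v => by
        fin_cases v <;> exact Subgroup.isClosed_topologicalClosure _
      isClosed_nodeGp := fun _ => Subgroup.isClosed_topologicalClosure _
      isClosed_cuspGp := fun _ => Subgroup.isClosed_topologicalClosure _
      nodeGp_le := fun _ => ⟨0, 1, rfl,
        ⟨1, by rw [one_smul, freeFactor_singleton_eq]; exact hle _ _ (hgen _ 1 (by simp))⟩,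
        ⟨1, by rw [one_smul, freeFactor_singleton_eq]; exact hle _ _ (hgen _ 1 (by simp))⟩⟩
      cuspGp_le := fun j => ⟨1, by
        rw [one_smul]
        fin_cases j
        · exact hle _ _ hc0
        · exact hle _ _ hc1
        · exact hle _ _ hc2
        · exact hle _ _ hc3⟩
      proSigma := ⟨fun _ _ _ hp _ => hp⟩ }
  have hT : Ω.IsOfPSCType T :=
    ⟨inferInstance, inferInstance, inferInstance, inferInstance, {p | p.Prime}, η, b, 0, 1, id,
      ⟨2, Nat.prime_two⟩, fun _ hp => hp, hη, ⟨hb0, hb1, hb2⟩,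
      by change (0 : Fin 2) ≠ 1; decide,
      fun v => by fin_cases v <;> simp, rfl, rfl, fun _ => rfl, fun _ _ => rfl,
      Function.injective_id, fun _ => rfl, by change (0 : ℕ) < 2; norm_num⟩
  obtain ⟨h12ii, h12i⟩ := prop12Holds_of_twoTripod Ω fun Q _ _ _ G hG => by
    obtain ⟨_, h1, h2, h3, hrest⟩ := hG
    exact ⟨h1, h2, h3, hrest⟩
  exact ⟨Ω, ⟨T, hT, rfl, rfl, rfl, rfl, fun _ => rfl⟩, h12ii, h12i,
    edgeLikeIncidenceHolds_of_twoTripod Ω fun Q _ _ G hG => hG⟩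

end Origin

end PSCDatum

end Literature.AnabelianGeometry.SemiGraphs

end
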